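import Literature.Probability.Percolation.TriQuadProtection
import Literature.Probability.Percolation.TriQuadStagesBK
import Literature.Probability.Percolation.TriUQuadRestrict
import HarnessLib

/-!
# From an arm to the canonical lowest crossing it is rerouted into

Topic `Literature/Probability/Percolation`; family `crit-perc`, statement **crit-perc.S16**
(`Literature.Probability.Percolation.triTheta_exponent`). The use of the rerouting lemma in
P. Nolin's proof of the separation lemma (EJP 13 (2008), §4.4, proof of Lemma 15
[arXiv 0711.4948: Lemma 14]: "Take the piece of `c'₁` between its extremity `z'₁` and its last
intersection `a₁` with `c_{v₁}`, and replace it with the corresponding piece of `c_{v₁}`: this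
gives `c''₁`. This new crossing has the same extremity on `∂S_N` as `c'₁`"), packaged for the
canonical crossings of `TriQuadProtection.lean`:

* `TriQuad.exists_stage_chain` — for every open `L–R` crossing of the quad in `ω` there is a
  stage `u < numStages ω` at which an open crossing avoids `N_u`, such that **every site of the
  canonical support `canonSupport (canonSet ω u)` is joined to the far end of the crossing by an
  `ω`-open path of `U`** (so the whole canonical crossing, its tip included, belongs to the open
  cluster of the arm).
* `exists_stage_chain_uQuad` — the same for an open crossing of the bigger region `U_{k,N}`
  (`2k ≤ N`): restricted to `U_{k,2k}` (`exists_uCross_restrict`) it is rerouted inside the quad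
  `uQuad k (2k)`, and the canonical support is joined to the far boundary `uR k N` inside
  `U_{k,N} ∩ ω`.

Closed arms are handled by applying these to `ωᶜ` (`TriQuad.stages_compl`).

## References

* P. Nolin, Near-critical percolation in two dimensions, *Electron. J. Probab.* 13 (2008), §4.4,
  proof of Lemma 15 [arXiv 0711.4948: Lemma 14] [Nolin2008].

## Mathlib / tree

Tree: `TriQuad.exists_stage_reroute` (`TriQuadStages.lean`), `canonSupport_spec`,
`exists_crossing_canonSet`, `hasCanon_of_pathIn` (`TriQuadProtection.lean`),
`lt_numStages_of_lrPath` (`TriQuadStagesBK.lean`), `exists_uCross_restrict`, `uL_eq_uL`,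
`uSites_subset_uSites` (`TriUQuadRestrict.lean`), `PathIn.exists_support`.
-/

noncomputable section

open Set

namespace Literature.Probability.Percolation

open LatticeModels

namespace TriQuad

variable {Q : TriQuad}

/-- **The canonical crossing an arm is rerouted into lies in the arm's open cluster.** For an
open `L–R` crossing `x ⋯ y` of `Q` (sites in `U ∩ ω`) there is a stage `u < numStages ω` with an
open crossing avoiding `N_u`, such that every site of `canonSupport (canonSet ω u)` is joined to
`y` by an `ω`-open path of `U`. [cite: Nolin2008, §4.4, proof of Lemma 15 (rerouting; arXiv 0711.4948: Lemma 14)] -/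
theorem exists_stage_chain {ω : Set (Site 2)} {x y : Site 2} (hx : x ∈ Q.L) (hy : y ∈ Q.R)
    (hp : PathIn triGraph (↑Q.U ∩ ω) x y) :
    ∃ u, u < Q.numStages ω ∧ Q.LRPath (ω \ ↑(Q.stages ω u)) ∧
      ∀ g ∈ Q.canonSupport (Q.canonSet ω u), PathIn triGraph (↑Q.U ∩ ω) g y := by
  obtain ⟨Sα, hSα, hpα, hallα⟩ := hp.exists_support
  obtain ⟨u, -, hLR, H⟩ := exists_stage_reroute hSα hx hy hpα hallα
  refine ⟨u, lt_numStages_of_lrPath (Or.inl hLR), hLR, fun g hg => ?_⟩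
  -- the canonical crossing of stage `u + 1`
  obtain ⟨x', hx', y', hy', hp'⟩ := exists_crossing_canonSet hLR
  have hcan : Q.HasCanon (Q.canonSet ω u) := hasCanon_of_pathIn hx' hy' hp'
  obtain ⟨hlL, hSγ, ⟨yγ, hyγ, hpγ⟩, hall, -⟩ := canonSupport_spec hcan
  have hSγ1 : Q.canonSupport (Q.canonSet ω u) ⊆ ↑Q.U ∩ (ω \ ↑(Q.stages ω u)) := fun z hz => (hSγ hz).1
  have hSγ2 : Q.canonSupport (Q.canonSet ω u) ⊆ ↑(Q.explored (ω \ ↑(Q.stages ω u))) := fun z hz => (hSγ hz).2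
  obtain ⟨z, hz, z', hz', hzz'⟩ := H hSγ1 hSγ2 hlL hyγ hpγ hall
  have hγU : Q.canonSupport (Q.canonSet ω u) ⊆ ↑Q.U ∩ ω := fun v hv => ⟨(hSγ1 hv).1, (hSγ1 hv).2.1⟩
  -- g → tip → z inside the canonical support, z → z' by rerouting, z' → x → y along the arm
  have h1 : PathIn triGraph (↑Q.U ∩ ω) g z := ((hall g hg).symm.trans (hall z hz)).mono hγU
  have h2 : PathIn triGraph (↑Q.U ∩ ω) z z' := hzz'.mono fun v hv => ⟨hv.1, hv.2.1⟩
  have h3 : PathIn triGraph (↑Q.U ∩ ω) z' y := ((hallα z' hz').symm.trans hpα).mono hSα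
  exact (h1.trans h2).trans h3

end TriQuad

/-- **The same for arms of the bigger U-shaped region.** An `ω`-open crossing of `U_{k,N}` from
the inner arc to `uR k N` (`1 ≤ k`, `2k ≤ N`) is rerouted inside the quad `uQuad k (2k)`: there is
a stage `u < numStages ω` of that quad with an open crossing avoiding `N_u`, every site of whose
canonical support is joined to the far boundary `uR k N` by an `ω`-open path of `U_{k,N}`. [cite: Nolin2008, §4.4, proof of Lemma 15 (arXiv 0711.4948: Lemma 14)] -/
theorem exists_stage_chain_uQuad {k N : ℕ} (hk : 1 ≤ k) (hkN : k + 1 ≤ 2 * k) (hN : 2 * k ≤ N)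
    {ω : Set (Site 2)} {a b : Site 2} (ha : a ∈ uL k N) (hb : b ∈ uR k N)
    (hp : PathIn triGraph ((↑(uSites k N) : Set (Site 2)) ∩ ω) a b) :
    ∃ u, u < (uQuad k (2 * k) hk hkN).numStages ω ∧
      (uQuad k (2 * k) hk hkN).LRPath (ω \ ↑((uQuad k (2 * k) hk hkN).stages ω u)) ∧
      ∀ g ∈ (uQuad k (2 * k) hk hkN).canonSupport ((uQuad k (2 * k) hk hkN).canonSet ω u),
        ∃ b' ∈ uR k N, PathIn triGraph ((↑(uSites k N) : Set (Site 2)) ∩ ω) g b' := by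
  have hkN' : k + 1 ≤ N := hkN.trans hN
  obtain ⟨c, hc, hpre, hpost⟩ := exists_uCross_restrict hk hkN hN ha hb hp
  have ha' : a ∈ uL k (2 * k) := by rwa [uL_eq_uL hk hkN' hkN] at ha
  obtain ⟨u, hu, hLR, H⟩ :=
    TriQuad.exists_stage_chain (Q := uQuad k (2 * k) hk hkN) (x := a) (y := c) ha' hc hpre
  refine ⟨u, hu, hLR, fun g hg => ⟨b, hb, ?_⟩⟩
  have hsub : (↑(uSites k (2 * k)) : Set (Site 2)) ∩ ω ⊆ ↑(uSites k N) ∩ ω := fun z hz =>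
    ⟨uSites_subset_uSites hN hz.1, hz.2⟩
  exact ((H g hg).mono hsub).trans hpost

end Literature.Probability.Percolation
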